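import Summits.Ventures.QEC.CircuitDistance.PortK2DataBB144Z
import Summits.Ventures.QEC.CircuitDistance.K2Chunks
import HarnessLib

/-!
# K2(`[[144,12,12]]`) chunk module — COMPUTATIONAL (native_decide; `Lean.ofReduceBool`)

Cell `qec`, CDX, R146/R152 STEP 1 («computational» header; `ofReduceBool` confined to these chunk modules). Checker of record
`K2.K2Data` (qec-cdx-type-1, PortK2Check); data module of record `PortK2DataBB144X/Z` (p669158/9, crit-1 data audit PASS
2026-08-28T21:20Z); chunk glue `K2Chunks` (idea-1 g2). Cube 0, child 11: leaf group 5 of 6.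
Leaf theorems: the K2 DFS accepts below one descendant state of pivot cube 0 (sector Z); sizes are exact DFS visit counts
(eng-1 g2 `k2count.c`), capped so that the gate's native-axiom audit re-verifies every leaf in place. Assemblies re-derive the
child lists in the kernel (`decide`) and end in the literal cube fact `d144Z.cube (Ts144Z.getD 0 []) (0) (lives144Z.getD 0 0) = true`
(the `hcubes` hypothesis of `K2Inst.k2_complete`). Emitted by qec-cdx-eng-1 g2 (`gen2.py`, idea-1's `gen_k2chunks_from_lean.py` lineage).
-/

namespace Summit.Ventures.QEC.CircuitDistance.K2

set_option maxRecDepth 100000 in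
set_option maxHeartbeats 0 in
set_option exponentiation.threshold 1024 in
/-- K2(144) chunk fact `cube144Z0_ch11_14` (405401 DFS visits; see the module docstring). -/
theorem cube144Z0_ch11_14 : app5 (d144Z.dfs (Ts144Z.getD 0 []) 6) (2436142297124905713664, 1672, 56539106494157465220894266815445503241161213975600188262087843458607742977, 3, 2348542582773833227889480596789336970835699013985838904394837952095403493668446908780268444352920914562645980) = true := by native_decide

set_option maxRecDepth 100000 in
set_option maxHeartbeats 0 in
set_option exponentiation.threshold 1024 in
/-- K2(144) chunk fact `cube144Z0_ch11_15` (317651 DFS visits; see the module docstring). -/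
theorem cube144Z0_ch11_15 : app5 (d144Z.dfs (Ts144Z.getD 0 []) 6) (74959055692331223040, 3724, 3618502789087380273660822028313169231149368750076848007835245945264529211393, 3, 2348542582773833227889480596789333352332910347854731917801556430598283078981426107512642211303420667277344732) = true := by native_decide

set_option maxRecDepth 100000 in
set_option maxHeartbeats 0 in
set_option exponentiation.threshold 1024 in
/-- K2(144) chunk fact `cube144Z0_ch11_16` (800885 DFS visits; see the module docstring). -/
theorem cube144Z0_ch11_16 : app5 (d144Z.dfs (Ts144Z.getD 0 []) 6) (372412839062986031104, 4, 3978585891278293137243479234341240949550440878489516421252987395526878172545284248174593, 3, 2348542582773833227885502010898055059195667289869557351080752781391904297241902395697496935327320400273080284) = true := by native_decide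

set_option maxRecDepth 100000 in
set_option maxHeartbeats 0 in
set_option exponentiation.threshold 1024 in
/-- K2(144) chunk fact `cube144Z0_ch11_17` (374785 DFS visits; see the module docstring). -/
theorem cube144Z0_ch11_17 : app5 (d144Z.dfs (Ts144Z.getD 0 []) 6) (1255550957882435436800, 1692, 31828687130226345097944885130563207995175985323140988597918970101543810005247153278025729, 3, 2348542582773833227853673323767828714097722825988160817314323587740874043325712701176334727518518264238964700) = true := by native_decide
end Summit.Ventures.QEC.CircuitDistance.K2
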